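import Summits.BirchSwinnertonDyer.BirchSwinnertonDyer.Theses.TwoAdicConverse
import Summits.BirchSwinnertonDyer.BirchSwinnertonDyer.Theorems.TwoAdicConverseLambdaHalfDefs
import Summits.BirchSwinnertonDyer.BirchSwinnertonDyer.Theorems.AlignedTransportAtTwoMainConjectureTransportAlignedAtTwoBridge
import Summits.BirchSwinnertonDyer.Rank1Residual.F1Sign2.AnalyticLineTransferAtTwo
import Literature.NumberTheory.IwasawaTheory.PruferPontryaginDual
import HarnessLib

/-!
# UNREGISTERED, PARAMETRIC line skeleton `elliptic_shadow_two` (crux-ideate r1, ideator 1, GEN 5) — crux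
# `OrdLambdaHalfAtTwo` (item stmt-BirchSwinnertonDyer-19556, route TwoAdicConverse, rung S3); card `Ideas/elliptic-shadow-two.md` v1.2

RESERVE #1 of the pen's pick (PEN-PICK-19556-r1 + ADDENDA 1–2; triage `TRIAGE-r1-2.md` §A: PASS-WITH-PRICE, prices P1–P4,
first rung R0).  Written by an IDEATOR, not by a lead: published with `ledger crux write … Lines/elliptic_shadow_two.lean`, NOT
`skeleton check --crux` (nothing here keys staffing).  It is PARAMETRIC in the shadow invariant `Φ` ON PURPOSE:

* WHY PARAMETRIC (design lesson, GEN 5).  The two walls of the pincer — (SH-an) `λ_an(E) + Σe_ℓ(E) = Φ(K) + Σe_ℓ(ρ_K)` and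
  (SH-alg) `Φ(K) + Σe_ℓ(ρ_K) ≤ λ_alg(E) + Σe_ℓ(E)` — have independent content ONLY for the INTENDED `Φ(K)` = the
  `λ`-invariant of the Greenberg–Vatsal Selmer dual `X_{χ,ε}(ℚ_∞)` of the Artin member `ρ_K = Ind_K^ℚ 𝟙 ⊖ 𝟙` at `p = 2`
  (a CURVE-FREE invariant of the cubic field `K`).  Closing the skeleton by Hilbert-`ε` ("`Φ :=` some function satisfying
  SH-an") was tried and REJECTED: then SH-an(Φ_ε) ⟺ «corrected `λ_an` is a class function of `K`» (genuine rigidity) but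
  SH-alg(Φ_ε) is, given SH-an, LITERALLY the crux restricted to `𝔖⁻` — a costume that hides all difficulty in one stub.
  Hence: `Φ` stays a parameter; the Φ-walls enter the composition as HYPOTHESES; the Φ-free inputs are closed `stub_*`;
  and the line becomes registrable exactly when the DEFINITION item D1 (`artinShadowLambdaAtTwo`, R0 of the triage: the
  `Λ`-module `X_{χ,ε}(ℚ_∞)` of `ρ_K` on `GreenbergSelmer.selmerInfty` over the sum-zero permutation module
  `{f : (K →ₐ[ℚ] ℚ̄) → QpModZp 2 | Σ f = 0}` with the `ε`-line local datum at the dyadic place, and its `λ`) lands —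
  then `stub_analyticShadow : ShadowAnalyticIdentityAtTwo D1.Φ` (P4) and `stub_residualTransportAtTwo_rigid :
  SelmerTwoTorsionFiniteOnRigidLocus → ShadowAlgebraicBoundAtTwo D1.Φ` (P2, with P3 = JLK 2011 Thm 5.2 in `𝒪_χ`-form +
  cyclotomic descent as its Literature input) are closed statements.
* `stub_muZero_rigidLocus` (P1 = SH-μ, DECLARED OPEN INPUT — the μ-ledger): on `𝔖⁻`, `Sel_{2^∞}(E/ℚ_∞)[2]` is finite
  (⟺ `X(E/ℚ_∞)` is `ℤ₂`-finitely generated ⟺ `X` torsion ∧ `μ₂(E) = 0`, tree `X5/TwoAdicTargetsTowerGapEnd`).  By the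
  tree facts `prop416_classicalMuVanishes_divisionField_two_of_fineSelmer_twoTorsion_finite` (Greenberg 2011 Prop.
  4.1.6/Rem. 4.1.7 + Ferrero–Washington) it IMPLIES Iwasawa's classical `μ₂ = 0` for `ℚ(E[2])^{cyc}`, and by
  `Lim2017.thm35_at_two_…_divisionField_four` (with `L = K`) classical `μ₂(K^{cyc}) = 0` gives back statement (A) at
  `(E, 2)`: every residual `λ`-method on the `S₃` stratum carries this input — it is NOT bookkeeping (card v1.1 said
  «algebra only»: corrected here and, independently, by the triage's P1).  Certifiable per cubic field by Fukuda's
  rank-stability test (tree fact `IwasawaTheory.fukuda1994_thm1_classGroupPRank_const_of_succ_eq`) + the tower-gap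
  certificate (`X5.TwoAdicTargetsTowerGap.finite_of_card_quotient_lt`).
* `stub_offRigidLocus` (RESIDUAL, not this card's): off `𝔖⁻` = the habitats of L1 `gv-mixed-descent-two` (rational
  `2`-torsion), L2 `f4-semisimple-cubic-two` / L3 `five-flag-plane-two` / Kilford (`Δ ∈ ℚ₂ˣ²`), and the `Δ > 0`,
  `Δ ∉ ℚ₂ˣ²` gap — keyed by the dyadic datum `w₂` per the pen's KEYING CONSTRAINT (RC-246 (B)); cited, not merged.
* PROVED here: `cubicFieldWitness` (on `𝔖⁻` the `u`-cubic is irreducible — tree theorem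
  `AlignedTransportAtTwoBridge.irreducible_twoDivisionUCubic` — so `K = ℚ[u]/(c_W)` is a cubic number field with a root of
  `c_W`), the pincer `lambdaHalfAtTwo_of_shadow`, and the composition `OrdLambdaHalfAtTwo_of Φ` concluding the ROUTE decl
  `Summit.BirchSwinnertonDyer.BirchSwinnertonDyer.Theses.TwoAdicConverse.OrdLambdaHalfAtTwo` BY NAME from SH-an(Φ), SH-μ,
  (SH-μ → SH-alg(Φ)) and the off-locus residual.  `sorry` occurs only inside the two closed `stub_*`.

The definitions `OnRigidLocusAtTwo`, `shadowCorrectionAtTwo`, `ShadowAnalyticIdentityAtTwo`, `ShadowAlgebraicBoundAtTwo`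
are VERBATIM copies of `Cruxes/OrdLambdaHalfAtTwo/EllipticShadowTwoSketch.lean` (GEN 3; that module is not built, so
it cannot be imported) placed in this file's own namespace.  Nothing about BSD is asserted or proved here; BSD is not
proved; the crux stays OPEN.
-/

set_option linter.dupNamespace false
set_option autoImplicit false

noncomputable section

open scoped Classical MatrixGroups ModularForm
open CongruenceSubgroup Polynomial WeierstrassCurve
open Literature.NumberTheory.EllipticCurves Literature.NumberTheory.EllipticCurves.ModularForms
open Literature.NumberTheory.EllipticCurves.Greenberg1999
open Literature.NumberTheory.EllipticCurves.Rank1Residual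
open Summit.BirchSwinnertonDyer.Rank1Residual.X1.MuLambda
open Summit.BirchSwinnertonDyer.Rank1Residual.F1Sign2
open Summit.BirchSwinnertonDyer.BirchSwinnertonDyer.Theorems.TwoAdicTwistConverse
open IsDedekindDomain NumberField

namespace Summit.BirchSwinnertonDyer.BirchSwinnertonDyer.Cruxes.OrdLambdaHalfAtTwo.EllipticShadowTwoLine

/-! ### §0 Copied definitions (verbatim from `EllipticShadowTwoSketch.lean`, GEN 3) -/

/-- The RIGID LOCUS `𝔖⁻` at `2`: `Δ < 0`, `Δ` not a square in `ℚ₂`, no rational `2`-torsion. (Copy.) -/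
def OnRigidLocusAtTwo (W : WeierstrassCurve ℚ) : Prop :=
  W.Δ < 0 ∧ ¬ IsSquare ((W.Δ : ℚ) : ℚ_[2]) ∧ ∀ x : ℚ, ¬ HasRationalTwoTorsionX W x

/-- The Artin local `λ`-correction `e_ℓ(ρ_K)` at an odd prime `ℓ`, `ρ_K = Ind_K^ℚ 𝟙 ⊖ 𝟙`. (Copy.) -/
def shadowCorrectionAtTwo (K : Type) [Field K] [NumberField K] (ℓ : ℕ) : ℕ :=
  2 ^ matsunoIndex ℓ *
    ((∑ P ∈ IsDedekindDomain.primesOverFinset (Ideal.span {(ℓ : ℤ)}) (𝓞 K), 2 ^ padicValNat 2 (P.inertiaDeg ℤ)) - 1)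

/-- **(SH-an)** analytic shadow identity on `𝔖⁻` for a candidate invariant `Φ` of cubic fields. (Copy.) -/
def ShadowAnalyticIdentityAtTwo (Φ : ∀ (K : Type) [Field K] [NumberField K], ℕ) : Prop :=
  ∀ (W : WeierstrassCurve ℚ) [W.IsElliptic] [W.IsGloballyMinimal], OnRigidLocusAtTwo W → IsOrdinaryAt W 2 →
    ∀ (K : Type) [Field K] [NumberField K], Module.finrank ℚ K = 3 →
    ∀ e : K, aeval e (twoDivisionUCubic W) = 0 →
    ∀ [NeZero (W.conductorNorm ℤ)] (f : CuspForm (Gamma0 (W.conductorNorm ℤ)) 2), IsNewformOf W f →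
      ∃ (c : ℚ) (L₀ : IwasawaAlgebra 2), L₀ ≠ 0 ∧
        iwasawaToPowerSeries 2 L₀ = PowerSeries.C (c : ℚ_[2]) * padicLFunction f (unitRoot W 2 : ℚ_[2]) ∧
        lam L₀ + ∑ ℓ ∈ (W.conductorNorm ℤ).primeFactors.erase 2, lambdaCorrectionAtTwo W ℓ =
          Φ K + ∑ ℓ ∈ (W.conductorNorm ℤ).primeFactors.erase 2, shadowCorrectionAtTwo K ℓ

/-- **(SH-alg)** algebraic shadow bound on `𝔖⁻` for a candidate invariant `Φ`. (Copy.) -/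
def ShadowAlgebraicBoundAtTwo (Φ : ∀ (K : Type) [Field K] [NumberField K], ℕ) : Prop :=
  ∀ (W : WeierstrassCurve ℚ) [W.IsElliptic] [W.IsGloballyMinimal], OnRigidLocusAtTwo W → IsOrdinaryAt W 2 →
    ∀ (K : Type) [Field K] [NumberField K], Module.finrank ℚ K = 3 →
    ∀ e : K, aeval e (twoDivisionUCubic W) = 0 →
    ∀ (κ : ZpExtension ℚ 2) (γ : Field.absoluteGaloisGroup ℚ),
      κ.IsCyclotomic → κ.IsTopGenerator γ → IsCyclotomicVariable 2 γ →
    ∀ (D : W.SelmerDualData κ γ),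
      Φ K + ∑ ℓ ∈ (W.conductorNorm ℤ).primeFactors.erase 2, shadowCorrectionAtTwo K ℓ ≤
        D.lambda + ∑ ℓ ∈ (W.conductorNorm ℤ).primeFactors.erase 2, lambdaCorrectionAtTwo W ℓ

/-! ### §1 New in GEN 5: the μ-ledger predicate (P1) and the D1-SPEC of the Artin module (R0) -/

/-- **(SH-μ) on `𝔖⁻`: `Sel_{2^∞}(E/ℚ_∞)[2]` is finite** for every good-ordinary curve on the rigid locus and every
cyclotomic `ℤ₂`-extension datum — the intrinsic, guard-free spelling of «`X(E/ℚ_∞)` is finitely generated over `ℤ₂`»,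
i.e. (`X5.TwoAdicTargetsTowerGapEnd`) «`X` is `Λ`-torsion and `μ₂(E) = 0`».  By the tree facts
`prop416_classicalMuVanishes_divisionField_two_of_fineSelmer_twoTorsion_finite` (via `Sel ⊇ Sel_fine`) it implies
Iwasawa's classical `μ₂ = 0` for `ℚ(E[2])^{cyc}`; conversely `Lim2017.thm35_at_two_…` (with `L` the cubic field) gives
statement (A) from classical `μ₂(K^{cyc}) = 0`.  DECLARED OPEN INPUT of the line.  Nothing asserted. -/
def SelmerTwoTorsionFiniteOnRigidLocus : Prop :=
  ∀ (W : WeierstrassCurve ℚ) [W.IsElliptic] [W.IsGloballyMinimal], OnRigidLocusAtTwo W → IsOrdinaryAt W 2 →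
    ∀ (κ : ZpExtension ℚ 2), κ.IsCyclotomic → Set.Finite {s : W.selmerInfty κ | 2 • s = 0}

/-- **D1-SPEC (R0, typed): «`M` is the Artin module `ρ_K ⊗ ℚ₂/ℤ₂` of the cubic field `K`»** — there is an injective
additive map `ι : M → (Emb(K, ℚ̄) → ℚ₂/ℤ₂)` onto the SUM-ZERO functions on the three embeddings `K →ₐ[ℚ] ℚ̄`, equivariant for
the absolute Galois group `Γ_ℚ = Aut_ℚ(ℚ̄)` acting on `M` and, by composition, on the embeddings
(`(σ • f)(σ ∘ e) = f(e)`).  Since `3 ∈ ℤ₂ˣ`, `Ind_K^ℚ 𝟙 = 𝟙 ⊕ ρ_K` integrally, so this pins `M` down up to `Γ_ℚ`-isomorphism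
(the definition item D1 then builds `X_{χ,ε}(ℚ_∞)` := Pontryagin dual of `GreenbergSelmer.selmerInfty κ_cyc M L_ε`, `L_ε` the
`ε`-line local datum at the dyadic place, and `artinShadowLambdaAtTwo K ε := λ(X_{χ,ε})`; cotorsion is a THEOREM to prove,
GV20 Prop. 4.2 analogue at `p = 2`).  A predicate only; nothing asserted. -/
def IsArtinModuleOfCubicField (K : Type) [Field K] [NumberField K]
    (M : Type) [AddCommGroup M] [DistribMulAction (Field.absoluteGaloisGroup ℚ) M] : Prop :=
  ∃ ι : M →+ ((K →ₐ[ℚ] AlgebraicClosure ℚ) → Literature.NumberTheory.IwasawaTheory.QpModZp 2),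
    Function.Injective ι ∧
    (∀ f : (K →ₐ[ℚ] AlgebraicClosure ℚ) → Literature.NumberTheory.IwasawaTheory.QpModZp 2,
      f ∈ Set.range ι ↔ ∑ e, f e = 0) ∧
    ∀ (σ : Field.absoluteGaloisGroup ℚ) (m : M) (e : K →ₐ[ℚ] AlgebraicClosure ℚ),
      ι (σ • m) ((show AlgebraicClosure ℚ ≃ₐ[ℚ] AlgebraicClosure ℚ from σ).toAlgHom.comp e) = ι m e

/-! ### §2 The two closed stubs (sorries live ONLY here); the Φ-walls are hypotheses of §3 -/

/-- **stub (SH-μ, declared open input)**: finiteness of `Sel_{2^∞}(E/ℚ_∞)[2]` on `𝔖⁻` (⟹ classical `μ₂(ℚ(E[2])^{cyc}) = 0`). -/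
theorem stub_muZero_rigidLocus : SelmerTwoTorsionFiniteOnRigidLocus := by
  sorry

/-- **stub (RESIDUAL — the other lines' habitats)**: off the rigid locus (rational `2`-torsion = L1, `Δ ∈ ℚ₂ˣ²` =
Kilford/L2–L3, `Δ > 0` with `Δ ∉ ℚ₂ˣ²` = the recorded gap), keyed by the dyadic datum `w₂` (pen RC-246 (B)). -/
theorem stub_offRigidLocus : ∀ (W : WeierstrassCurve ℚ) [W.IsElliptic] [W.IsGloballyMinimal],
    ¬ W.HasCM → GoodOrd W 2 → ¬ OnRigidLocusAtTwo W → LambdaHalfAtTwo W := by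
  sorry

/-! ### §3 Proved: the cubic-field witness, the pincer, the composition -/

/-- **Cubic-field witness (PROVED).** On the rigid locus the `u`-cubic `c_W` is irreducible over `ℚ` (no rational
`2`-torsion; tree theorem `irreducible_twoDivisionUCubic`), so `K = ℚ[u]/(c_W)` is a number field of degree `3`
containing a root of `c_W`. -/
theorem cubicFieldWitness (W : WeierstrassCurve ℚ) [W.IsElliptic] (hW : OnRigidLocusAtTwo W) :
    ∃ (K : Type) (_ : Field K) (_ : NumberField K), Module.finrank ℚ K = 3 ∧
      ∃ e : K, aeval e (twoDivisionUCubic W) = 0 := by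
  have hirr : Irreducible (twoDivisionUCubic W) :=
    Summit.BirchSwinnertonDyer.BirchSwinnertonDyer.Theorems.AlignedTransportAtTwoBridge.irreducible_twoDivisionUCubic
      W hW.2.2
  haveI : Fact (Irreducible (twoDivisionUCubic W)) := ⟨hirr⟩
  have hne : twoDivisionUCubic W ≠ 0 := hirr.ne_zero
  refine ⟨AdjoinRoot (twoDivisionUCubic W), inferInstance, inferInstance, ?_, AdjoinRoot.root _, ?_⟩
  · have h := (AdjoinRoot.powerBasis hne).finrank
    rw [AdjoinRoot.powerBasis_dim,
      Summit.BirchSwinnertonDyer.BirchSwinnertonDyer.Theorems.AlignedTransportAtTwoBridge.natDegree_twoDivisionUCubic]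
      at h
    convert h
  · -- the statement's `ℚ`-algebra structure on `K` is `algebraRat`; `AdjoinRoot`'s is `AdjoinRoot.of` — ring maps
    -- out of `ℚ` are unique, so `convert` closes the instance mismatch by `Subsingleton.elim`.
    have h := AdjoinRoot.eval₂_root (twoDivisionUCubic W)
    have hmap : algebraMap ℚ (AdjoinRoot (twoDivisionUCubic W)) = AdjoinRoot.of (twoDivisionUCubic W) :=
      Subsingleton.elim _ _
    rw [Polynomial.aeval_def, hmap]
    exact h

/-- **The pincer (PROVED; copy of GEN 3 `lambdaHalfAtTwo_of_shadow`).** -/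
theorem lambdaHalfAtTwo_of_shadow (Φ : ∀ (K : Type) [Field K] [NumberField K], ℕ)
    (han : ShadowAnalyticIdentityAtTwo Φ) (halg : ShadowAlgebraicBoundAtTwo Φ)
    (W : WeierstrassCurve ℚ) [W.IsElliptic] [W.IsGloballyMinimal] (hW : OnRigidLocusAtTwo W)
    (K : Type) [Field K] [NumberField K] (hK : Module.finrank ℚ K = 3)
    (e : K) (he : aeval e (twoDivisionUCubic W) = 0) :
    LambdaHalfAtTwo W := by
  intro κ γ hκ hγ hvar hord _ f hf D
  obtain ⟨c, L₀, hL₀, hι, hsum⟩ := han W hW hord K hK e he f hf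
  have hle := halg W hW hord K hK e he κ γ hκ hγ hvar D
  exact ⟨c, L₀, hL₀, hι, by omega⟩

/-- **Composition (PROVED, no sorry), PARAMETRIC in the shadow invariant `Φ`**: SH-an(Φ), SH-μ, (SH-μ → SH-alg(Φ))
and the off-locus residual imply the crux, concluded BY NAME as the route decl.  Instantiate `Φ := D1.Φ`
(`artinShadowLambdaAtTwo`, the `λ` of `X_{χ,ε}(ℚ_∞)` of `ρ_K` at `2`) once the definition item lands. -/
theorem OrdLambdaHalfAtTwo_of (Φ : ∀ (K : Type) [Field K] [NumberField K], ℕ) :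
    ShadowAnalyticIdentityAtTwo Φ →
    SelmerTwoTorsionFiniteOnRigidLocus →
    (SelmerTwoTorsionFiniteOnRigidLocus → ShadowAlgebraicBoundAtTwo Φ) →
    (∀ (W : WeierstrassCurve ℚ) [W.IsElliptic] [W.IsGloballyMinimal],
      ¬ W.HasCM → GoodOrd W 2 → ¬ OnRigidLocusAtTwo W → LambdaHalfAtTwo W) →
    Summit.BirchSwinnertonDyer.BirchSwinnertonDyer.Theses.TwoAdicConverse.OrdLambdaHalfAtTwo := by
  intro han hμ halg hoff
  show Summit.BirchSwinnertonDyer.BirchSwinnertonDyer.Theorems.TwoAdicTwistConverse.OrdLambdaHalfAtTwo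
  intro W _ _ hCM hgood
  by_cases hW : OnRigidLocusAtTwo W
  · obtain ⟨K, iF, iN, hK, e, he⟩ := cubicFieldWitness W hW
    exact lambdaHalfAtTwo_of_shadow Φ han (halg hμ) W hW K hK e he
  · exact hoff W hCM hgood hW

/-- The crux from the two closed stubs and the two Φ-walls (sanity instance; asserts nothing new). -/
theorem ordLambdaHalfAtTwo_of_stubs (Φ : ∀ (K : Type) [Field K] [NumberField K], ℕ)
    (han : ShadowAnalyticIdentityAtTwo Φ) (halg : SelmerTwoTorsionFiniteOnRigidLocus → ShadowAlgebraicBoundAtTwo Φ) :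
    Summit.BirchSwinnertonDyer.BirchSwinnertonDyer.Theses.TwoAdicConverse.OrdLambdaHalfAtTwo :=
  OrdLambdaHalfAtTwo_of Φ han stub_muZero_rigidLocus halg stub_offRigidLocus

end Summit.BirchSwinnertonDyer.BirchSwinnertonDyer.Cruxes.OrdLambdaHalfAtTwo.EllipticShadowTwoLine

end
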